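import Summits.Schanuel.Schanuel.Theorems.DiophantineDichotomyApproximationPropertyZeroDimDictionary
import Mathlib.Analysis.SpecialFunctions.Pow.Real
import HarnessLib

/-!
# Stub plan `CycleAPIAt3`, P7 lemmas: positivity of `|𝔭(ω̄)|` off the orbit and the real analysis of the glue

Crux `stmt-Schanuel-6117` (`Summit.Schanuel.Schanuel.Theses.DiophantineDichotomy.ApproximationProperty`),
line `orbit-interpolation-determinant`, registered stub `CycleAPIAt3 : CycleAPIAt 3`; stub plan
`Cruxes/ApproximationProperty/STUB-PLAN-CycleAPIAt3.md` (P7: the satellite restart composed from the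
orbit floor P2, the container height P3/P3′ and the container restart P4 — file
`…CycleAPIAt3SatelliteRestart.lean`, which imports this one). Contents (all PROVED, no definitions):

* `iabs_pos_of_far` (registered sub-goal) — if every zero of a homogeneous prime `𝔭 ⊂ ℚ[x₀, …, x₃]` of
  rank `1` is at positive projective distance from `ω̄ = (1 : ω)` then `|𝔭(ω̄)| > 0` (dictionary (D) of
  the landed `stub_zeroDimDictionary`: `|𝔭(ω̄)| ≥ e^{−cD} ∏_σ ‖ω̄ − σb‖`);
* `SatelliteRestartGlue.eq_of_mem_associatedPrimes_of_isPrime`, `rank_eq_two`, `one_le_ideg_two` —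
  bookkeeping on primes (Prop. 4.4: the Chow form of a rank-`2` prime is irreducible, so `deg ≥ 1`);
* `SatelliteRestartGlue.log_budget` — `8 C c log(D+2) ≤ Δ` for `D ≤ (cΔ)³`, `Δ ≥ 3136 C² c³`;
* `SatelliteRestartGlue.sqrt_absorb` — `√(D (h + D + δ log(D+2)) L) ≤ 2 √(D (h + D) L)` for `9δ² ≤ D`;
* `SatelliteRestartGlue.hbar_add_one_nonneg`.

Sources: NesterenkoPhilippon2001 (LNM 1752) Ch. 3 §4 (Prop. 4.4, Def. 4.6); folklore real analysis.
-/

noncomputable section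

-- `Summit.Schanuel.Schanuel.…` is the mandated summit/sub-problem namespace (single-conjunct summit), hence:
set_option linter.dupNamespace false

attribute [local instance] MvPolynomial.gradedAlgebra

namespace Summit.Schanuel.Schanuel.Cruxes.ApproximationProperty.OrbitInterpolationDeterminant

open Literature.NumberTheory.Transcendental.Nesterenko MvPolynomial
open scoped BigOperators

namespace SatelliteRestartGlue

/-- The associated primes of a prime ideal are the ideal itself. [folklore] -/
theorem eq_of_mem_associatedPrimes_of_isPrime {m : ℕ} {𝔭 𝔯 : Ideal (Rx m)} (h𝔭 : 𝔭.IsPrime)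
    (h𝔯 : 𝔯 ∈ 𝔭.associatedPrimes) : 𝔯 = 𝔭 := by
  obtain ⟨h𝔯prime, x, hx⟩ := Submodule.isAssociatedPrime_def.mp h𝔯
  by_cases hxp : x ∈ 𝔭
  · have htop : Submodule.colon 𝔭 {x} = ⊤ := by
      rw [eq_top_iff]
      intro a _
      exact Submodule.mem_colon_singleton.mpr (by simpa using 𝔭.mul_mem_left a hxp)
    rw [htop, Ideal.radical_top] at hx
    exact absurd hx h𝔯prime.ne_top
  · have hcol : Submodule.colon 𝔭 {x} = 𝔭 := by
      ext a
      rw [Submodule.mem_colon_singleton, smul_eq_mul]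
      exact ⟨fun h => (h𝔭.mem_or_mem h).resolve_right hxp, fun h => 𝔭.mul_mem_right x h⟩
    rw [hx, hcol, h𝔭.radical]

/-- A prime which is unmixed of rank `2` has `dim ℚ[x̲]/𝔮 = 2`. [folklore] -/
theorem rank_eq_two {𝔮 : Ideal (Rx 3)} (h𝔮 : 𝔮.IsPrime) (hunm : IsUnmixedOfRank 𝔮 2) :
    ringKrullDim (Rx 3 ⧸ 𝔮) = (2 : ℕ) := by
  refine hunm.2 𝔮 ⟨h𝔮, 1, ?_⟩
  have hcol : Submodule.colon 𝔮 {(1 : Rx 3)} = 𝔮 := by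
    ext a; rw [Submodule.mem_colon_singleton, smul_eq_mul, mul_one]
  rw [hcol, h𝔮.radical]

/-- The degree of a homogeneous prime of rank `2` is `≥ 1`.
[cite: NesterenkoPhilippon2001, Ch. 3 Prop. 4.4 (p. 38)] -/
theorem one_le_ideg_two {𝔮 : Ideal (Rx 3)} (h𝔮 : 𝔮.IsPrime)
    (hhom : 𝔮.IsHomogeneous (homogeneousSubmodule (Fin (3 + 1)) ℚ)) (hunm : IsUnmixedOfRank 𝔮 2) :
    1 ≤ ideg 𝔮 2 := by
  haveI := h𝔮
  exact one_le_ideg_of_irreducible_chowForm (by norm_num)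
    (prime_chowForm 𝔮 hhom (by norm_num) (rank_eq_two h𝔮 hunm)).irreducible

/-- The logarithmic budget: `8 C c log(D+2) ≤ Δ` when `D ≤ (cΔ)³` and `Δ ≥ 3136 C² c³`
(`log(D+2) ≤ log(2(cΔ)³) ≤ 1 + 3(2√(cΔ) − 2) ≤ 6√(cΔ)` and `(48 C c)² cΔ ≤ Δ²`). [folklore] -/
theorem log_budget {C c Δ D : ℝ} (hC : 1 ≤ C) (hc : 1 ≤ c) (hΔ : 3136 * C ^ 2 * c ^ 3 ≤ Δ)
    (hD0 : 0 ≤ D) (hD : D ≤ (c * Δ) ^ 3) : 8 * C * c * Real.log (D + 2) ≤ Δ := by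
  have hCc : 1 ≤ C ^ 2 * c ^ 3 := one_le_mul_of_one_le_of_one_le (one_le_pow₀ hC) (one_le_pow₀ hc)
  have hΔ1 : 3136 ≤ Δ := by
    have := mul_le_mul_of_nonneg_left hCc (by norm_num : (0:ℝ) ≤ 3136); linarith
  have hΔ0 : 0 ≤ Δ := by linarith
  set x : ℝ := c * Δ with hx
  have hx2 : 2 ≤ x := by
    rw [hx]
    calc (2 : ℝ) ≤ 1 * 3136 := by norm_num
      _ ≤ c * Δ := mul_le_mul hc hΔ1 (by norm_num) (by linarith)
  have hx0 : 0 < x := by linarith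
  have hlog1 : Real.log (D + 2) ≤ Real.log (2 * x ^ 3) := by
    apply Real.log_le_log (by linarith)
    have : (2 : ℝ) ^ 3 ≤ x ^ 3 := pow_le_pow_left₀ (by norm_num) hx2 3
    linarith
  have hlog2 : Real.log (2 * x ^ 3) = Real.log 2 + 3 * Real.log x := by
    rw [Real.log_mul (by norm_num) (by positivity), Real.log_pow]; norm_num
  have hlogx : Real.log x ≤ 2 * Real.sqrt x - 2 := by
    have h := Real.log_le_sub_one_of_pos (Real.sqrt_pos.mpr hx0)
    rw [Real.log_sqrt hx0.le] at h
    linarith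
  have hlog2' : Real.log 2 ≤ 1 := by
    have := Real.log_two_lt_d9; linarith
  have hsqrt1 : 1 ≤ Real.sqrt x := by
    rw [show (1 : ℝ) = Real.sqrt 1 from Real.sqrt_one.symm]
    exact Real.sqrt_le_sqrt (by linarith)
  have hlog : Real.log (D + 2) ≤ 6 * Real.sqrt x := by linarith
  have hkey : 48 * C * c * Real.sqrt x ≤ Δ := by
    have h1 : (48 * C * c * Real.sqrt x) ^ 2 ≤ Δ ^ 2 := by
      rw [mul_pow, Real.sq_sqrt hx0.le, hx]
      calc (48 * C * c) ^ 2 * (c * Δ) = (2304 * (C ^ 2 * c ^ 3)) * Δ := by ring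
        _ ≤ Δ * Δ := mul_le_mul_of_nonneg_right (by linarith) hΔ0
        _ = Δ ^ 2 := by ring
    exact (pow_le_pow_iff_left₀ (by positivity) hΔ0 two_ne_zero).mp h1
  have hC0 : 0 ≤ 8 * C * c := by positivity
  calc 8 * C * c * Real.log (D + 2) ≤ 8 * C * c * (6 * Real.sqrt x) :=
        mul_le_mul_of_nonneg_left hlog hC0
    _ = 48 * C * c * Real.sqrt x := by ring
    _ ≤ Δ := hkey

/-- Absorbing the `δ log(D+2)` term of the orbit floor into `D` when `9δ² ≤ D`:
`√(D (h + D + δ log(D+2)) L) ≤ 2 √(D (h + D) L)`. [folklore] -/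
theorem sqrt_absorb {D h L δ : ℝ} (hD : 1 ≤ D) (hh : 0 ≤ h) (hL : 0 ≤ L) (hδ : 0 ≤ δ)
    (hδD : 9 * δ ^ 2 ≤ D) :
    Real.sqrt (D * (h + D + δ * Real.log (D + 2)) * L) ≤ 2 * Real.sqrt (D * (h + D) * L) := by
  -- `δ log(D+2) ≤ 2 δ √(D+2) ≤ 3 D`
  have hlog : Real.log (D + 2) ≤ 2 * Real.sqrt (D + 2) := by
    have h := Real.log_le_sub_one_of_pos (Real.sqrt_pos.mpr (by linarith : (0:ℝ) < D + 2))
    rw [Real.log_sqrt (by linarith)] at h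
    linarith
  have hlog0 : 0 ≤ Real.log (D + 2) := Real.log_nonneg (by linarith)
  have h1 : δ * Real.log (D + 2) ≤ 3 * D := by
    have h2 : (2 * δ * Real.sqrt (D + 2)) ^ 2 ≤ (3 * D) ^ 2 := by
      rw [mul_pow, Real.sq_sqrt (by linarith)]
      have hD0 : 0 ≤ D := by linarith
      nlinarith [mul_le_mul_of_nonneg_right hδD (by linarith : (0:ℝ) ≤ D + 2),
        mul_le_mul_of_nonneg_left hD hD0]
    have h3 : 2 * δ * Real.sqrt (D + 2) ≤ 3 * D :=
      (pow_le_pow_iff_left₀ (by positivity) (by positivity) two_ne_zero).mp h2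
    calc δ * Real.log (D + 2) ≤ δ * (2 * Real.sqrt (D + 2)) := mul_le_mul_of_nonneg_left hlog hδ
      _ = 2 * δ * Real.sqrt (D + 2) := by ring
      _ ≤ 3 * D := h3
  have hin : D * (h + D + δ * Real.log (D + 2)) * L ≤ 4 * (D * (h + D) * L) := by
    have : h + D + δ * Real.log (D + 2) ≤ 4 * (h + D) := by nlinarith
    have hDL : 0 ≤ D * L := by positivity
    nlinarith [mul_le_mul_of_nonneg_left this hDL]
  calc Real.sqrt (D * (h + D + δ * Real.log (D + 2)) * L)
      ≤ Real.sqrt (4 * (D * (h + D) * L)) := Real.sqrt_le_sqrt hin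
    _ = 2 * Real.sqrt (D * (h + D) * L) := by
        rw [Real.sqrt_mul' 4 (by positivity), show (4 : ℝ) = 2 ^ 2 by norm_num,
          Real.sqrt_sq (by norm_num)]


/-- `0 ≤ h(𝔭)/deg 𝔭 + 1`. [folklore] -/
theorem hbar_add_one_nonneg (𝔭 : Ideal (Rx 3)) : 0 ≤ iheight 𝔭 1 / ideg 𝔭 1 + 1 :=
  add_nonneg (div_nonneg (height_nonneg _) (Nat.cast_nonneg _)) zero_le_one

end SatelliteRestartGlue

/-- **Registered sub-goal `iabs_pos_of_far` — positivity of `|𝔭(ω̄)|` off the orbit**: if every zero of the rank-`1` homogeneous prime `𝔭`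
is at positive projective distance from `ω̄ = (1 : ω)`, then `|𝔭(ω̄)| > 0` (dictionary (D):
`|𝔭(ω̄)| ≥ e^{−cD} ∏_σ ‖ω̄ − σb‖`). [cite: NesterenkoPhilippon2001, Ch. 3 §4 (Prop. 4.4, property 3)] -/
theorem iabs_pos_of_far : ∀ (𝔭 : Ideal (Rx 3)) (ω : Fin 3 → ℂ), 𝔭.IsPrime →
    𝔭.IsHomogeneous (homogeneousSubmodule (Fin (3 + 1)) ℚ) → IsUnmixedOfRank 𝔭 1 →
    (∀ β ∈ projZeros 𝔭, 0 < projDist (Fin.cons 1 ω) β) → 0 < iabs 𝔭 1 (Fin.cons 1 ω) := by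
  intro 𝔭 ω h𝔭 hhom hunm hfar
  obtain ⟨cZ, _, hZ⟩ := stub_zeroDimDictionary 3 (by norm_num)
  obtain ⟨K, _, _, b, hb0, hA, -, -, -, hD, -⟩ := hZ 𝔭 h𝔭 hhom hunm
  have hω : (Fin.cons 1 ω : Fin (3 + 1) → ℂ) ≠ 0 :=
    Literature.NumberTheory.Transcendental.PhilipponMain.cons_one_ne_zero ω
  refine lt_of_lt_of_le ?_ (hD (Fin.cons 1 ω) hω)
  refine mul_pos (Real.exp_pos _) (Finset.prod_pos fun σ _ => hfar _ ?_)
  refine (hA _).mpr ⟨?_, σ, 1, funext fun j => by rw [one_mul]⟩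
  obtain ⟨j, hj⟩ := Function.ne_iff.mp hb0
  exact Function.ne_iff.mpr ⟨j, by simpa using hj⟩

end Summit.Schanuel.Schanuel.Cruxes.ApproximationProperty.OrbitInterpolationDeterminant

end
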